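import Mathlib.LinearAlgebra.Matrix.Rank
import Mathlib.LinearAlgebra.FiniteDimensional.Lemmas
import Mathlib.Data.ZMod.Basic
import Mathlib.Algebra.BigOperators.Ring.Finset

/-!
# Crux `CubicForrelation.NearExactIsExact` (stmt-QuantumAdvantage-14043) — n = 12, E1280-even: three generic obstructions to a PAIRING
  PARTNER (radical vector, dual bases, rank count)

Certificate seat `b2b-cforr-cert` (gen 39).  HONEST FRAMING: kernel-checked elementary linear algebra over `𝔽₂` (standard axioms) — the
generic facts 0.2, 0.4, 0.5 of HOME/b2b-cforr-cert-g39/E1280-HANDPROOFS.md, which turn the exhaustive enumerations of the computer-assisted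
closure of "E1280-even" (cert seats g36/g37) into hand proofs.  By themselves they say nothing about `θ₁₂`; NOT summit progress.

* `tpr_radical_obstruction` (0.2): if the 3-form `d` has a radical vector `u ≠ 0` (`ι_u d = 0`, i.e. `Σ_φ u_φ d_{φjk} = 0` for all `j,k`)
  then the partner equations `Σ_{j<k} c_{pjk} d_{φjk} = [p = φ]` have no solution `c` (sum the equations against `u_φ`).  Kills the R4
  leaves x₁q₄, T-I, T-II and the R2 leaf T⊕T′ (E1280-HANDPROOFS §2.1–2.3, §1.7).
* `tpr_dual_basis` (0.4): `Σ_i b_i a_iᵀ = 1 ⇒ a_i · b_j = δ_{ij}` (the `a_i` are the dual basis) — the R2 leaves s₀ω₆ and s₀ω₄(a)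
  (§1.4, §1.5: the light structure makes `⟨G, A⟩ = g·α`, which must be both `0` and `1`).
* `tpr_rank_obstruction` (0.5): `X A + Y B = 1_k ⇒ rank X + rank Y ≥ k` — the R2 leaves T(b) and s₀ω₄(b) (§1.1, §1.6: the light structure
  bounds the ranks of the F′-rows of `G` and `Γ` by `3 < 6`, resp. `2 < 4`).  Stated over a field `K`; for concrete `ZMod 2` matrices use the
  rank-free form `tpr_outer_sum_obstruction` (APPENDED): `Σ_i b_i a_iᵀ = 1_k` forces every `b_i ≠ 0` (instance-unification of `Matrix.rank`
  at `K = ZMod 2` against the `CommRing` instance is impractically slow, so the outer-product form is the one to apply).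

References: this work (cert seats g36–g39).  Axioms: the standard three.
-/

set_option linter.dupNamespace false -- D-0017: single-problem summit ⇒ `QuantumAdvantage.QuantumAdvantage` by design

namespace Summit.QuantumAdvantage.QuantumAdvantage.Theorems.CubicForrelation.NearExactIsExact

open Finset Matrix

/-- **Radical obstruction (0.2).**  If `c` is a pairing partner of `d` (`Σ_{j<k} c_{pjk} d_{φjk} = [p = φ]` for all `p, φ`) then `d` has
trivial radical: any `u` with `Σ_φ u_φ d_{φjk} = 0` for all `j, k` is `0`.  (Sum the equations at `(p, φ)` against `u_φ`: the left side
becomes `Σ_{j<k} c_{pjk} (ι_u d)_{jk} = 0`, the right side `u_p`.) [this work] -/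
theorem tpr_radical_obstruction {n : ℕ} (c d : Fin n → Fin n → Fin n → ZMod 2)
    (hpair : ∀ p φ, (∑ j, ∑ k, (if j < k then c p j k * d φ j k else 0)) = if p = φ then 1 else 0)
    (u : Fin n → ZMod 2) (hu : ∀ j k, (∑ φ, u φ * d φ j k) = 0) : u = 0 := by
  funext p
  have h : (∑ φ, u φ * ∑ j, ∑ k, (if j < k then c p j k * d φ j k else 0)) = ∑ φ, u φ * (if p = φ then 1 else 0) :=
    Finset.sum_congr rfl fun φ _ => by rw [hpair p φ]
  have hr : (∑ φ, u φ * (if p = φ then (1 : ZMod 2) else 0)) = u p := by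
    simp only [mul_ite, mul_one, mul_zero]
    rw [Finset.sum_ite_eq]
    simp
  have hl : (∑ φ, u φ * ∑ j, ∑ k, (if j < k then c p j k * d φ j k else 0)) =
      ∑ j, ∑ k, (if j < k then c p j k * ∑ φ, u φ * d φ j k else 0) := by
    have hterm : ∀ φ, u φ * (∑ j, ∑ k, (if j < k then c p j k * d φ j k else 0)) =
        ∑ j, ∑ k, (if j < k then c p j k * (u φ * d φ j k) else 0) := by
      intro φ
      rw [Finset.mul_sum]
      refine Finset.sum_congr rfl fun j _ => ?_
      rw [Finset.mul_sum]
      refine Finset.sum_congr rfl fun k _ => ?_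
      split_ifs <;> ring
    rw [Finset.sum_congr rfl fun φ _ => hterm φ, Finset.sum_comm]
    refine Finset.sum_congr rfl fun j _ => ?_
    rw [Finset.sum_comm]
    refine Finset.sum_congr rfl fun k _ => ?_
    by_cases hjk : j < k
    · simp only [hjk, if_true]
      rw [Finset.mul_sum]
    · simp only [hjk, if_false, Finset.sum_const_zero]
  rw [hl, hr] at h
  rw [← h]
  simp only [hu, mul_zero, ite_self, Finset.sum_const_zero, Pi.zero_apply]

/-- **Dual bases (0.4).**  Over a commutative ring: if vectors `b_1, …, b_k` and `a_1, …, a_k` in `R^k` satisfy `Σ_i b_i a_iᵀ = 1`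
(entrywise: `Σ_i b_i[r] a_i[s] = [r = s]`), then `a_i · b_j = [i = j]`. [this work] -/
theorem tpr_dual_basis {R : Type*} [CommRing R] {k : ℕ} (b a : Fin k → Fin k → R)
    (h : ∀ r s, (∑ i, b i r * a i s) = if r = s then 1 else 0) (i j : Fin k) :
    (∑ r, a i r * b j r) = if i = j then 1 else 0 := by
  set Bm : Matrix (Fin k) (Fin k) R := Matrix.of fun r i => b i r with hBm
  set Am : Matrix (Fin k) (Fin k) R := Matrix.of fun i s => a i s with hAm
  have hBA : Bm * Am = 1 := by
    ext r s
    rw [Matrix.mul_apply, Matrix.one_apply]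
    simpa [hBm, hAm] using h r s
  have hAB : Am * Bm = 1 := mul_eq_one_comm.mp hBA
  have := congrFun (congrFun hAB i) j
  rw [Matrix.mul_apply, Matrix.one_apply] at this
  simpa [hBm, hAm] using this

/-- Rank is subadditive for matrices over a field. [folklore] -/
theorem tpr_rank_add_le {K : Type*} [Field K] {k p : ℕ} (M N : Matrix (Fin k) (Fin p) K) : (M + N).rank ≤ M.rank + N.rank := by
  unfold Matrix.rank
  rw [Matrix.mulVecLin_add]
  calc Module.finrank K ↥(LinearMap.range (M.mulVecLin + N.mulVecLin))
      ≤ Module.finrank K ↥(LinearMap.range M.mulVecLin ⊔ LinearMap.range N.mulVecLin) :=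
        Submodule.finrank_mono (LinearMap.range_add_le _ _)
    _ ≤ Module.finrank K ↥(LinearMap.range M.mulVecLin) + Module.finrank K ↥(LinearMap.range N.mulVecLin) :=
        Submodule.finrank_add_le_finrank_add_finrank _ _

/-- **Rank obstruction (0.5).**  Over a field: `X A + Y B = 1_k` forces `rank X + rank Y ≥ k`. [this work] -/
theorem tpr_rank_obstruction {K : Type*} [Field K] {k p q : ℕ} (X : Matrix (Fin k) (Fin p) K) (A : Matrix (Fin p) (Fin k) K)
    (Y : Matrix (Fin k) (Fin q) K) (B : Matrix (Fin q) (Fin k) K) (h : X * A + Y * B = 1) : k ≤ X.rank + Y.rank := by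
  have h1 : (X * A + Y * B).rank = k := by rw [h, Matrix.rank_one, Fintype.card_fin]
  have h2 := tpr_rank_add_le (X * A) (Y * B)
  have h3 := Matrix.rank_mul_le_left X A
  have h4 := Matrix.rank_mul_le_left Y B
  omega


/-- **Outer-product obstruction (0.5, rank-free form).**  If `Σ_i b_i a_iᵀ = 1_k` (entrywise `Σ_i b_i[r] a_i[s] = [r = s]`) then no `b_i`
vanishes — so `1_k` is not a sum of fewer than `k` outer products (pad with zero vectors).  This is the form in which the light structure
is used: T(b) gives `G_{F,·}A + Γ_{F,·}B` as a sum of at most `1 + 2 < 6` outer products, s₀ω₄(b) as at most `1 + 1 < 4`. [this work] -/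
theorem tpr_outer_sum_obstruction {R : Type*} [CommRing R] [Nontrivial R] {k : ℕ} (b a : Fin k → Fin k → R)
    (h : ∀ r s, (∑ i, b i r * a i s) = if r = s then 1 else 0) (i₀ : Fin k) (hb : b i₀ = 0) : False := by
  have hd := tpr_dual_basis b a h i₀ i₀
  rw [if_pos rfl] at hd
  have : (∑ r, a i₀ r * b i₀ r) = 0 := Finset.sum_eq_zero fun r _ => by rw [hb, Pi.zero_apply, mul_zero]
  rw [this] at hd
  exact zero_ne_one hd

end Summit.QuantumAdvantage.QuantumAdvantage.Theorems.CubicForrelation.NearExactIsExact
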